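import Literature.Geometry.DiscreteGeometry.LayerShellPatterns

/-!
# The `45°` covering angle of the FCC and HCP kissing patterns

Helper file for stub `stub_cubicGrowth` of line `develop-the-model-growth-descent`
(crux `ShellsToBarlowChart`, stmt-AtomisticToContinuum-9227).

For every vector `u` of `ℝ³` there is a point `v` of the FCC pattern, and a point of the HCP
pattern, with `√2 · ⟪u, v⟫ ≥ ‖u‖`, i.e. every direction is within `45°` of a pattern point
(`fcc_coveringAngle`, `hcp_coveringAngle`).  FCC: the two largest coordinates of `u` in absolute
value, with their signs, give `v = (±e_a ± e_b)/√2` and `⟪u, v⟫ = (|u_a| + |u_b|)/√2 ≥ ‖u‖/√2`.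
HCP: if `u₀ + u₁ + u₂ ≥ 0` a hexagon or upper-cap point works; otherwise reflect `u` in the
hexagon plane `x + y + z = 0` — the reflection fixes the hexagon and maps the upper cap of the
pattern onto its lower cap.
-/

noncomputable section

namespace Summit.AtomisticToContinuum.Crystallization.Theorems.PalmUnimodularRigidityShellsToBarlowChart

open Literature.Geometry.DiscreteGeometry

/-- `⟪u, v⟫` for an integer vector `v`, in coordinates. [folklore] -/
theorem inner_intVec_right (u : EuclideanSpace ℝ (Fin 3)) (v : Fin 3 → ℤ) :
    inner ℝ u (intVec v) = u 0 * v 0 + u 1 * v 1 + u 2 * v 2 := by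
  rw [EuclideanSpace.inner_eq_star_dotProduct, dotProduct, Fin.sum_univ_three]
  simp [intVec]
  ring

/-- The two largest coordinates dominate the norm: `‖u‖ ≤ |u_i| + |u_j|` for some pair `i ≠ j`.
[folklore] -/
theorem norm_le_abs_add_abs (u : EuclideanSpace ℝ (Fin 3)) :
    ‖u‖ ≤ |u 0| + |u 1| ∨ ‖u‖ ≤ |u 0| + |u 2| ∨ ‖u‖ ≤ |u 1| + |u 2| := by
  have h : ‖u‖ ^ 2 = u 0 ^ 2 + u 1 ^ 2 + u 2 ^ 2 := by
    rw [EuclideanSpace.norm_sq_eq, Fin.sum_univ_three]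
    simp [sq_abs]
  have h0 := abs_nonneg (u 0)
  have h1 := abs_nonneg (u 1)
  have h2 := abs_nonneg (u 2)
  rw [← sq_abs (u 0), ← sq_abs (u 1), ← sq_abs (u 2)] at h
  have key : ∀ p q r : ℝ, 0 ≤ p → 0 ≤ q → 0 ≤ r → r ≤ p → r ≤ q →
      ‖u‖ ^ 2 = p ^ 2 + q ^ 2 + r ^ 2 → ‖u‖ ≤ p + q := by
    intro p q r hp hq hr hrp hrq huu
    refine (pow_le_pow_iff_left₀ (norm_nonneg u) (by positivity) two_ne_zero).1 ?_
    nlinarith [mul_le_mul hrp hrq hr hp]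
  rcases le_total |u 0| |u 1| with hab | hba
  · rcases le_total |u 0| |u 2| with hac | hca
    · exact Or.inr (Or.inr (key _ _ _ h1 h2 h0 hab hac (by rw [h]; ring)))
    · exact Or.inl (key _ _ _ h0 h1 h2 hca (hca.trans hab) (by rw [h]))
  · rcases le_total |u 1| |u 2| with hbc | hcb
    · exact Or.inr (Or.inl (key _ _ _ h0 h2 h1 hba hbc (by rw [h]; ring)))
    · exact Or.inl (key _ _ _ h0 h1 h2 (hcb.trans hba) hcb (by rw [h]))

/-! ## FCC -/

/-- For each pair of coordinates an FCC vector realises `|u_i| + |u_j|` as an inner product.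
[folklore] -/
theorem exists_fccInt_inner_eq (u : EuclideanSpace ℝ (Fin 3)) :
    (∃ v ∈ fccInt, inner ℝ u (intVec v) = |u 0| + |u 1|) ∧
    (∃ v ∈ fccInt, inner ℝ u (intVec v) = |u 0| + |u 2|) ∧
    (∃ v ∈ fccInt, inner ℝ u (intVec v) = |u 1| + |u 2|) := by
  refine ⟨?_, ?_, ?_⟩
  · rcases le_total 0 (u 0) with h0 | h0 <;> rcases le_total 0 (u 1) with h1 | h1
    · exact ⟨![1, 1, 0], by decide, by simp [inner_intVec_right, abs_of_nonneg, h0, h1]⟩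
    · exact ⟨![1, -1, 0], by decide,
        by simp [inner_intVec_right, abs_of_nonneg, abs_of_nonpos, h0, h1]⟩
    · exact ⟨![-1, 1, 0], by decide,
        by simp [inner_intVec_right, abs_of_nonneg, abs_of_nonpos, h0, h1]⟩
    · exact ⟨![-1, -1, 0], by decide, by simp [inner_intVec_right, abs_of_nonpos, h0, h1]⟩
  · rcases le_total 0 (u 0) with h0 | h0 <;> rcases le_total 0 (u 2) with h1 | h1
    · exact ⟨![1, 0, 1], by decide, by simp [inner_intVec_right, abs_of_nonneg, h0, h1]⟩
    · exact ⟨![1, 0, -1], by decide,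
        by simp [inner_intVec_right, abs_of_nonneg, abs_of_nonpos, h0, h1]⟩
    · exact ⟨![-1, 0, 1], by decide,
        by simp [inner_intVec_right, abs_of_nonneg, abs_of_nonpos, h0, h1]⟩
    · exact ⟨![-1, 0, -1], by decide, by simp [inner_intVec_right, abs_of_nonpos, h0, h1]⟩
  · rcases le_total 0 (u 1) with h0 | h0 <;> rcases le_total 0 (u 2) with h1 | h1
    · exact ⟨![0, 1, 1], by decide, by simp [inner_intVec_right, abs_of_nonneg, h0, h1]⟩
    · exact ⟨![0, 1, -1], by decide,
        by simp [inner_intVec_right, abs_of_nonneg, abs_of_nonpos, h0, h1]⟩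
    · exact ⟨![0, -1, 1], by decide,
        by simp [inner_intVec_right, abs_of_nonneg, abs_of_nonpos, h0, h1]⟩
    · exact ⟨![0, -1, -1], by decide, by simp [inner_intVec_right, abs_of_nonpos, h0, h1]⟩

/-- The best FCC integer vector sees `u` at inner product `≥ ‖u‖`. [folklore] -/
theorem exists_fccInt_norm_le_inner (u : EuclideanSpace ℝ (Fin 3)) :
    ∃ v ∈ fccInt, ‖u‖ ≤ inner ℝ u (intVec v) := by
  obtain ⟨⟨v₁, hv₁, e₁⟩, ⟨v₂, hv₂, e₂⟩, ⟨v₃, hv₃, e₃⟩⟩ := exists_fccInt_inner_eq u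
  rcases norm_le_abs_add_abs u with h | h | h
  · exact ⟨v₁, hv₁, e₁ ▸ h⟩
  · exact ⟨v₂, hv₂, e₂ ▸ h⟩
  · exact ⟨v₃, hv₃, e₃ ▸ h⟩

/-- **The FCC pattern has covering angle `45°`**: every vector `u` of `ℝ³` is within `45°` of a
point `v` of the cuboctahedron, `√2 · ⟪u, v⟫ ≥ ‖u‖`. [folklore] -/
theorem fcc_coveringAngle : ∀ u : EuclideanSpace ℝ (Fin 3), ∃ v ∈ Literature.Geometry.DiscreteGeometry.fccKissingPattern, ‖u‖ ≤ Real.sqrt 2 * inner ℝ u v := by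
  intro u
  obtain ⟨v, hv, h⟩ := exists_fccInt_norm_le_inner u
  refine ⟨(Real.sqrt (2 : ℕ))⁻¹ • intVec v, Finset.mem_image_of_mem _ hv, ?_⟩
  rw [Nat.cast_ofNat, real_inner_smul_right, mul_inv_cancel_left₀ (by positivity)]
  exact h

/-! ## HCP -/

/-- On the closed upper side of the hexagon plane (`u₀ + u₁ + u₂ ≥ 0`) a hexagon or upper-cap
vector of the integer HCP model sees `u` at inner product `≥ 3‖u‖`. [folklore] -/
theorem exists_hexUpper_norm_le_inner (u : EuclideanSpace ℝ (Fin 3)) (hσ : 0 ≤ u 0 + u 1 + u 2) :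
    ∃ v ∈ ({![3, -3, 0], ![-3, 3, 0], ![3, 0, -3], ![-3, 0, 3], ![0, 3, -3], ![0, -3, 3],
        ![3, 3, 0], ![3, 0, 3], ![0, 3, 3]} : Finset (Fin 3 → ℤ)),
      3 * ‖u‖ ≤ inner ℝ u (intVec v) := by
  rcases norm_le_abs_add_abs u with h | h | h
  · rcases le_total 0 (u 0) with h0 | h0 <;> rcases le_total 0 (u 1) with h1 | h1
    · refine ⟨![3, 3, 0], by simp, ?_⟩
      rw [abs_of_nonneg h0, abs_of_nonneg h1] at h
      simp [inner_intVec_right]; linarith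
    · refine ⟨![3, -3, 0], by simp, ?_⟩
      rw [abs_of_nonneg h0, abs_of_nonpos h1] at h
      simp [inner_intVec_right]; linarith
    · refine ⟨![-3, 3, 0], by simp, ?_⟩
      rw [abs_of_nonpos h0, abs_of_nonneg h1] at h
      simp [inner_intVec_right]; linarith
    · refine ⟨![-3, 0, 3], by simp, ?_⟩
      rw [abs_of_nonpos h0, abs_of_nonpos h1] at h
      simp [inner_intVec_right]; linarith
  · rcases le_total 0 (u 0) with h0 | h0 <;> rcases le_total 0 (u 2) with h1 | h1
    · refine ⟨![3, 0, 3], by simp, ?_⟩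
      rw [abs_of_nonneg h0, abs_of_nonneg h1] at h
      simp [inner_intVec_right]; linarith
    · refine ⟨![3, 0, -3], by simp, ?_⟩
      rw [abs_of_nonneg h0, abs_of_nonpos h1] at h
      simp [inner_intVec_right]; linarith
    · refine ⟨![-3, 0, 3], by simp, ?_⟩
      rw [abs_of_nonpos h0, abs_of_nonneg h1] at h
      simp [inner_intVec_right]; linarith
    · refine ⟨![-3, 3, 0], by simp, ?_⟩
      rw [abs_of_nonpos h0, abs_of_nonpos h1] at h
      simp [inner_intVec_right]; linarith
  · rcases le_total 0 (u 1) with h0 | h0 <;> rcases le_total 0 (u 2) with h1 | h1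
    · refine ⟨![0, 3, 3], by simp, ?_⟩
      rw [abs_of_nonneg h0, abs_of_nonneg h1] at h
      simp [inner_intVec_right]; linarith
    · refine ⟨![0, 3, -3], by simp, ?_⟩
      rw [abs_of_nonneg h0, abs_of_nonpos h1] at h
      simp [inner_intVec_right]; linarith
    · refine ⟨![0, -3, 3], by simp, ?_⟩
      rw [abs_of_nonpos h0, abs_of_nonneg h1] at h
      simp [inner_intVec_right]; linarith
    · refine ⟨![3, -3, 0], by simp, ?_⟩
      rw [abs_of_nonpos h0, abs_of_nonpos h1] at h
      simp [inner_intVec_right]; linarith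

/-- The nine hexagon/upper-cap vectors lie in `hcpInt`; the hexagon ones have coordinate sum `0`,
the upper-cap ones have sum `6` and their mirror images `v − (4,4,4)` in the hexagon plane lie
in `hcpInt` (the lower cap). [folklore] -/
theorem hexUpper_mirror :
    ∀ v ∈ ({![3, -3, 0], ![-3, 3, 0], ![3, 0, -3], ![-3, 0, 3], ![0, 3, -3], ![0, -3, 3],
        ![3, 3, 0], ![3, 0, 3], ![0, 3, 3]} : Finset (Fin 3 → ℤ)),
      v ∈ hcpInt ∧ (v 0 + v 1 + v 2 = 0 ∨ (v 0 + v 1 + v 2 = 6 ∧ v - ![4, 4, 4] ∈ hcpInt)) := by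
  decide

/-- The best HCP integer vector sees `u` at inner product `≥ 3‖u‖` (hemisphere argument: reflect
in the hexagon plane when `u₀ + u₁ + u₂ ≤ 0`). [folklore] -/
theorem exists_hcpInt_norm_le_inner (u : EuclideanSpace ℝ (Fin 3)) :
    ∃ v ∈ hcpInt, 3 * ‖u‖ ≤ inner ℝ u (intVec v) := by
  rcases le_total 0 (u 0 + u 1 + u 2) with hσ | hσ
  · obtain ⟨v, hv, h⟩ := exists_hexUpper_norm_le_inner u hσ
    exact ⟨v, (hexUpper_mirror v hv).1, h⟩
  · -- reflect `u` in the plane `x + y + z = 0`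
    set t : ℝ := 2 * (u 0 + u 1 + u 2) / 3 with ht
    set u' : EuclideanSpace ℝ (Fin 3) := u - t • intVec ![1, 1, 1] with hu'
    have hc : ∀ i, u' i = u i - t := by intro i; fin_cases i <;> simp [hu']
    have hσ' : 0 ≤ u' 0 + u' 1 + u' 2 := by rw [hc, hc, hc]; linarith
    obtain ⟨v, hv, h⟩ := exists_hexUpper_norm_le_inner u' hσ'
    have hn : ‖u'‖ = ‖u‖ := by
      have h3 : ∀ w : EuclideanSpace ℝ (Fin 3), ‖w‖ ^ 2 = w 0 ^ 2 + w 1 ^ 2 + w 2 ^ 2 := by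
        intro w
        rw [EuclideanSpace.norm_sq_eq, Fin.sum_univ_three]
        simp [sq_abs]
      have h2 : ‖u'‖ ^ 2 = ‖u‖ ^ 2 := by
        rw [h3, h3, hc, hc, hc, ht]; ring
      exact (pow_left_inj₀ (norm_nonneg _) (norm_nonneg _) two_ne_zero).1 h2
    have hi : inner ℝ u' (intVec v) = inner ℝ u (intVec v) - t * ((v 0 + v 1 + v 2 : ℤ) : ℝ) := by
      rw [inner_intVec_right, inner_intVec_right, hc, hc, hc]; push_cast; ring
    rw [hn, hi] at h
    rcases (hexUpper_mirror v hv).2 with hs | ⟨hs, hmem⟩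
    · refine ⟨v, (hexUpper_mirror v hv).1, ?_⟩
      rw [hs] at h
      simpa using h
    · refine ⟨v - ![4, 4, 4], hmem, ?_⟩
      have hi' : inner ℝ u (intVec (v - ![4, 4, 4])) =
          inner ℝ u (intVec v) - 4 * (u 0 + u 1 + u 2) := by
        rw [inner_intVec_right, inner_intVec_right]; simp; ring
      rw [hi']
      rw [hs, ht] at h
      push_cast at h
      linarith

/-- **The HCP pattern has covering angle `45°`**: every vector `u` of `ℝ³` is within `45°` of a
point `v` of the anticuboctahedron, `√2 · ⟪u, v⟫ ≥ ‖u‖`. [folklore] -/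
theorem hcp_coveringAngle : ∀ u : EuclideanSpace ℝ (Fin 3), ∃ v ∈ Literature.Geometry.DiscreteGeometry.hcpKissingPattern, ‖u‖ ≤ Real.sqrt 2 * inner ℝ u v := by
  intro u
  obtain ⟨v, hv, h⟩ := exists_hcpInt_norm_le_inner u
  refine ⟨(Real.sqrt (18 : ℕ))⁻¹ • intVec v, Finset.mem_image_of_mem _ hv, ?_⟩
  rw [Nat.cast_ofNat, real_inner_smul_right, sqrt_eighteen_eq]
  have h2 : Real.sqrt 2 ≠ 0 := by positivity
  have : Real.sqrt 2 * ((3 * Real.sqrt 2)⁻¹ * inner ℝ u (intVec v)) = inner ℝ u (intVec v) / 3 := by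
    field_simp
  rw [this]
  linarith

end Summit.AtomisticToContinuum.Crystallization.Theorems.PalmUnimodularRigidityShellsToBarlowChart

end
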